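import Mathlib
import Summits.NavierStokesRegularity.NavierStokesRegularity.Theorems.PlaneEnergyCeilingSlabEnergyIdentityPointwise
import Summits.NavierStokesRegularity.NavierStokesRegularity.Theorems.PlaneEnergyCeilingPlanarEnergyAPrioriSlabLawDecay

/-!
# Route PlaneEnergyCeiling · crux `PlanarEnergyAPriori` — the weighted energy identity
# (integrability form)

Helper file for the crux item stmt-NavierStokesRegularity-16855 (`PlanarEnergyAPriori`, route
`PlaneEnergyCeiling`), landed `--supports` that item. THE WEIGHTED WHOLE-SPACE ENERGY IDENTITY:
for a `C²` divergence-free `u : ℝ³ → ℝ³`, a `C¹` scalar `p`, and a `C²` weight `g` of the height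
with `g, g', g''` bounded,

  `∫ g(x₂)·2⟪u, νΔu − (u·∇)u − ∇p⟫ = ν∫ g''(x₂)|u|² − 2ν ∫ g(x₂) Σⱼ‖∂ⱼu‖² + 2∫ g'(x₂)(|u|²/2 + p) u₂`,

stated here under INTEGRABILITY hypotheses only (`weightedEnergyIdentity_of_integrable`: the six
energy densities `|u|²`, `⟪u,∂ⱼu⟫`, `∂ⱼ⟪u,∂ⱼu⟫`, `‖∂ⱼu‖²`, `(|u|²/2+p)uⱼ`, `∂ⱼ((|u|²/2+p)uⱼ)`
integrable on `ℝ³`) — so that it serves pointwise-decay users (order-(3,2) decay: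
`weightedEnergyIdentity_of_decay`, through seat 3's landed `decayDensitiesIntegrable`) and
Sobolev-class users alike. It is the engine of the signed flux ledger
(`Theorems/…FluxLedger.lean`, where it enters as the hypothesis `hWI`) and of the mild slab law.

Proof: the pointwise local energy identity `two_mul_inner_acc`
(`2⟪u,acc⟫ = 2νΣⱼ∂ⱼ⟪u,∂ⱼu⟫ − 2νΣⱼ‖∂ⱼu‖² − 2Σⱼ∂ⱼ((|u|²/2+p)uⱼ)`), multiplied by `g(x₂)` and
integrated; whole-space integration by parts against the weight (Mathlib
`integral_bilinear_hasLineDerivAt_right_eq_neg_left_of_integrable`): in-plane derivatives see a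
constant weight and integrate to zero, the normal one produces `g'(x₂)`, and
`∫ g'(x₂)⟪u,∂₂u⟫ = −½∫ g''(x₂)|u|²`. Folklore (Caffarelli–Kohn–Nirenberg 1982 §2, the local
energy equality tested with a function of one coordinate).
-/

noncomputable section

-- single-conjunct summit: `Summit.<Summit>.<Problem>` repeats the name by the D-0017 layout
set_option linter.dupNamespace false

namespace Summit.NavierStokesRegularity.NavierStokesRegularity.Theorems.PlanarEnergyAPriori

open MeasureTheory Set Filter Topology Function WithLp
open scoped ENNReal RealInnerProductSpace Laplacian
open Literature.Analysis.FluidPDE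
open Summit.NavierStokesRegularity.NavierStokesRegularity.Theorems.PlaneEnergyCeilingSlabEnergyIdentity
open Summit.NavierStokesRegularity.NavierStokesRegularity.Theorems.PlanarEnergyAPriori.SlabLaw

/-! ### Line derivatives of weights of the height -/

/-- The line derivative of a weight of the height along a coordinate direction:
`∂_{eⱼ}[g(x₂)] = g'(x₂)` for `j = 2`, `0` otherwise. -/
theorem hasLineDerivAt_weight {g : ℝ → ℝ} (hg : Differentiable ℝ g) (x : EuclideanSpace ℝ (Fin 3)) (j : Fin 3) :
    HasLineDerivAt ℝ (fun x : EuclideanSpace ℝ (Fin 3) => g (x 2))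
      (if j = 2 then deriv g (x 2) else 0) x (EuclideanSpace.single j 1) := by
  set c : ℝ := if j = 2 then 1 else 0 with hc
  show HasDerivAt (fun t : ℝ => g ((x + t • EuclideanSpace.single j (1 : ℝ)) 2)) _ 0
  have hcoord : ∀ t : ℝ, (x + t • EuclideanSpace.single j (1 : ℝ)) 2 = x 2 + t * c := by
    intro t; rw [hc]; fin_cases j <;> simp
  simp_rw [hcoord]
  have hin : HasDerivAt (fun t : ℝ => x 2 + t * c) c 0 := by
    simpa using ((hasDerivAt_id (0 : ℝ)).mul_const c).const_add (x 2)
  have hG : HasDerivAt g (deriv g (x 2)) (x 2 + 0 * c) := by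
    rw [zero_mul, add_zero]; exact (hg _).hasDerivAt
  have h : HasDerivAt (fun t : ℝ => g (x 2 + t * c)) (deriv g (x 2) * c) 0 := hG.comp 0 hin
  refine h.congr_deriv ?_
  rw [hc]; split_ifs <;> simp

/-- The line derivative of a differentiable function along `eⱼ` is `Df(x) eⱼ`. -/
theorem hasLineDerivAt_of_differentiable {F : Type*} [NormedAddCommGroup F] [NormedSpace ℝ F]
    {f : EuclideanSpace ℝ (Fin 3) → F} (hf : Differentiable ℝ f) (x : EuclideanSpace ℝ (Fin 3)) (j : Fin 3) :
    HasLineDerivAt ℝ f (fderiv ℝ f x (EuclideanSpace.single j 1)) x (EuclideanSpace.single j 1) :=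
  (hf x).hasFDerivAt.hasLineDerivAt _

/-! ### Integration by parts against a weight of the height -/

/-- **Integration by parts against a weight of the height.** For a `C¹` weight `g` with `g, g'`
bounded and a differentiable `ψ : ℝ³ → ℝ` with `ψ` and `∂ⱼψ` integrable:
`∫ g(x₂) ∂ⱼψ = −∫ ∂ⱼ[g(x₂)] ψ` — which is `−∫ g'(x₂) ψ` for `j = 2` and `0` for the in-plane
directions. -/
theorem integral_weight_mul_fderiv_eq {g : ℝ → ℝ} (hg : ContDiff ℝ 1 g) {K : ℝ} (hgK : ∀ z, |g z| ≤ K)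
    (hg'K : ∀ z, |deriv g z| ≤ K) {ψ : EuclideanSpace ℝ (Fin 3) → ℝ} (hψ : Differentiable ℝ ψ)
    (hIψ : Integrable ψ) (j : Fin 3)
    (hIψ' : Integrable fun x => fderiv ℝ ψ x (EuclideanSpace.single j 1)) :
    ∫ x : EuclideanSpace ℝ (Fin 3), g (x 2) * fderiv ℝ ψ x (EuclideanSpace.single j 1) =
      -∫ x : EuclideanSpace ℝ (Fin 3), (if j = 2 then deriv g (x 2) else 0) * ψ x := by
  have hgd : Differentiable ℝ g := hg.differentiable one_ne_zero
  have hgc : Continuous g := hg.continuous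
  have hg'c : Continuous (deriv g) := hg.continuous_deriv le_rfl
  have h := integral_bilinear_hasLineDerivAt_right_eq_neg_left_of_integrable (μ := volume)
    (f := fun x : EuclideanSpace ℝ (Fin 3) => g (x 2))
    (f' := fun x => if j = 2 then deriv g (x 2) else 0) (g := ψ)
    (g' := fun x => fderiv ℝ ψ x (EuclideanSpace.single j 1)) (v := EuclideanSpace.single j 1)
    (B := ContinuousLinearMap.mul ℝ ℝ) ?_ ?_ ?_ ?_ ?_
  · simpa using h
  · -- `f' ψ` integrable
    by_cases hj : j = 2
    · simp only [hj, if_true, ContinuousLinearMap.mul_apply']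
      exact integrable_weight_mul hIψ hg'c hg'K
    · simp [hj]
  · simpa using integrable_weight_mul hIψ' hgc hgK
  · simpa using integrable_weight_mul hIψ hgc hgK
  · exact fun x _ => hasLineDerivAt_weight hgd x j
  · exact fun x _ => hasLineDerivAt_of_differentiable hψ x j

/-! ### The identity -/

section Identity

variable {u : EuclideanSpace ℝ (Fin 3) → EuclideanSpace ℝ (Fin 3)} {p : EuclideanSpace ℝ (Fin 3) → ℝ}

/-- **The viscous term.** `Σⱼ ∫ g(x₂) ∂ⱼ⟪u,∂ⱼu⟫ = ½ ∫ g''(x₂) |u|²` (two integrations by parts in the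
normal direction; the in-plane ones vanish). -/
theorem sum_integral_weight_mul_fderiv_inner_fderiv (hu : ContDiff ℝ 2 u) {g : ℝ → ℝ} (hg : ContDiff ℝ 2 g)
    {K : ℝ} (hgK : ∀ z, |g z| ≤ K) (hg'K : ∀ z, |deriv g z| ≤ K) (hg''K : ∀ z, |deriv (deriv g) z| ≤ K)
    (hIu2 : Integrable fun x => ‖u x‖ ^ 2)
    (hIψ : ∀ j : Fin 3, Integrable fun z => ⟪u z, fderiv ℝ u z (EuclideanSpace.single j 1)⟫)
    (hIψ' : ∀ j : Fin 3, Integrable fun x =>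
      fderiv ℝ (fun z => ⟪u z, fderiv ℝ u z (EuclideanSpace.single j 1)⟫) x (EuclideanSpace.single j 1)) :
    ∑ j : Fin 3, ∫ x, g (x 2) * fderiv ℝ (fun z => ⟪u z, fderiv ℝ u z (EuclideanSpace.single j 1)⟫) x
        (EuclideanSpace.single j 1) =
      2⁻¹ * ∫ x, deriv (deriv g) (x 2) * ‖u x‖ ^ 2 := by
  have hg1 : ContDiff ℝ 1 g := hg.of_le one_le_two
  have hg'1 : ContDiff ℝ 1 (deriv g) := (contDiff_succ_iff_deriv.mp (show ContDiff ℝ (1 + 1) g from hg)).2.2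
  have hdu : Differentiable ℝ u := hu.differentiable two_ne_zero
  -- first integration by parts, direction by direction
  have h1 : ∀ j : Fin 3, ∫ x, g (x 2) * fderiv ℝ (fun z => ⟪u z, fderiv ℝ u z (EuclideanSpace.single j 1)⟫) x
      (EuclideanSpace.single j 1) =
      -∫ x, (if j = 2 then deriv g (x 2) else 0) * ⟪u x, fderiv ℝ u x (EuclideanSpace.single j 1)⟫ := fun j =>
    integral_weight_mul_fderiv_eq hg1 hgK hg'K ((contDiff_inner_fderiv hu j).differentiable one_ne_zero)
      (hIψ j) j (hIψ' j)
  simp_rw [h1]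
  rw [Fin.sum_univ_three]
  simp only [Fin.isValue, show (0 : Fin 3) ≠ 2 by decide, show (1 : Fin 3) ≠ 2 by decide, if_false, if_true,
    zero_mul, integral_zero, neg_zero, zero_add]
  -- second integration by parts: `∫ g'(x₂)⟪u,∂₂u⟫ = −½ ∫ g''(x₂)|u|²`
  set ψ₀ : EuclideanSpace ℝ (Fin 3) → ℝ := fun z => ‖u z‖ ^ 2 / 2 + (fun _ : EuclideanSpace ℝ (Fin 3) => (0 : ℝ)) z
    with hψ₀
  have hψ₀d : Differentiable ℝ ψ₀ := fun x => differentiableAt_bernoulli hdu (differentiable_const _) x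
  have hψ₀' : ∀ x, fderiv ℝ ψ₀ x (EuclideanSpace.single 2 1) = ⟪u x, fderiv ℝ u x (EuclideanSpace.single 2 1)⟫ := by
    intro x
    rw [hψ₀, fderiv_bernoulli_apply hdu (differentiable_const _)]
    simp
  have hIψ₀ : Integrable ψ₀ := by
    have : ψ₀ = fun z => 2⁻¹ * ‖u z‖ ^ 2 := by funext z; simp [hψ₀]; ring
    rw [this]; exact hIu2.const_mul _
  have hIψ₀' : Integrable fun x => fderiv ℝ ψ₀ x (EuclideanSpace.single 2 1) := by
    simp_rw [hψ₀']; exact hIψ 2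
  have h2 := integral_weight_mul_fderiv_eq hg'1 hg'K hg''K hψ₀d hIψ₀ 2 hIψ₀'
  simp_rw [hψ₀'] at h2
  simp only [if_true] at h2
  rw [h2, neg_neg]
  have : (fun x : EuclideanSpace ℝ (Fin 3) => deriv (deriv g) (x 2) * ψ₀ x) =
      fun x => 2⁻¹ * (deriv (deriv g) (x 2) * ‖u x‖ ^ 2) := by
    funext x; simp [hψ₀]; ring
  rw [this, integral_const_mul]

/-- **The flux term.** `Σⱼ ∫ g(x₂) ∂ⱼ((|u|²/2 + p)uⱼ) = −∫ g'(x₂)(|u|²/2 + p)u₂`. -/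
theorem sum_integral_weight_mul_fderiv_bernoulli (hu : ContDiff ℝ 1 u) (hp : ContDiff ℝ 1 p) {g : ℝ → ℝ}
    (hg : ContDiff ℝ 1 g) {K : ℝ} (hgK : ∀ z, |g z| ≤ K) (hg'K : ∀ z, |deriv g z| ≤ K)
    (hIΦ : ∀ j : Fin 3, Integrable fun z => (‖u z‖ ^ 2 / 2 + p z) * u z j)
    (hIΦ' : ∀ j : Fin 3, Integrable fun x =>
      fderiv ℝ (fun z => (‖u z‖ ^ 2 / 2 + p z) * u z j) x (EuclideanSpace.single j 1)) :
    ∑ j : Fin 3, ∫ x, g (x 2) * fderiv ℝ (fun z => (‖u z‖ ^ 2 / 2 + p z) * u z j) x (EuclideanSpace.single j 1) =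
      -∫ x, deriv g (x 2) * ((‖u x‖ ^ 2 / 2 + p x) * u x 2) := by
  have h1 : ∀ j : Fin 3, ∫ x, g (x 2) * fderiv ℝ (fun z => (‖u z‖ ^ 2 / 2 + p z) * u z j) x
      (EuclideanSpace.single j 1) = -∫ x, (if j = 2 then deriv g (x 2) else 0) * ((‖u x‖ ^ 2 / 2 + p x) * u x j) :=
    fun j => integral_weight_mul_fderiv_eq hg hgK hg'K ((contDiff_bernoulli_mul hu hp j).differentiable one_ne_zero)
      (hIΦ j) j (hIΦ' j)
  simp_rw [h1]
  rw [Fin.sum_univ_three]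
  simp only [Fin.isValue, show (0 : Fin 3) ≠ 2 by decide, show (1 : Fin 3) ≠ 2 by decide, if_false, if_true,
    zero_mul, integral_zero, neg_zero, zero_add]

/-- **THE WEIGHTED ENERGY IDENTITY, integrability form.** For `C²` divergence-free `u`, `C¹` `p`,
a `C²` weight `g` of the height with `|g|, |g'|, |g''| ≤ K`, and the six energy densities
integrable on `ℝ³`:
`∫ g(x₂)·2⟪u, νΔu − (u·∇)u − ∇p⟫ = ν∫ g''|u|² − 2ν∫ gΣⱼ‖∂ⱼu‖² + 2∫ g'(|u|²/2 + p)u₂`. [folklore] -/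
theorem weightedEnergyIdentity_of_integrable (ν : ℝ) (hu : ContDiff ℝ 2 u) (hp : ContDiff ℝ 1 p)
    (hdiv : VectorCalculus.IsDivFree u) {g : ℝ → ℝ} (hg : ContDiff ℝ 2 g)
    {K : ℝ} (hgK : ∀ z, |g z| ≤ K) (hg'K : ∀ z, |deriv g z| ≤ K) (hg''K : ∀ z, |deriv (deriv g) z| ≤ K)
    (hIu2 : Integrable fun x => ‖u x‖ ^ 2)
    (hIψ : ∀ j : Fin 3, Integrable fun z => ⟪u z, fderiv ℝ u z (EuclideanSpace.single j 1)⟫)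
    (hIψ' : ∀ j : Fin 3, Integrable fun x =>
      fderiv ℝ (fun z => ⟪u z, fderiv ℝ u z (EuclideanSpace.single j 1)⟫) x (EuclideanSpace.single j 1))
    (hID : ∀ j : Fin 3, Integrable fun x => ‖fderiv ℝ u x (EuclideanSpace.single j 1)‖ ^ 2)
    (hIΦ : ∀ j : Fin 3, Integrable fun z => (‖u z‖ ^ 2 / 2 + p z) * u z j)
    (hIΦ' : ∀ j : Fin 3, Integrable fun x =>
      fderiv ℝ (fun z => (‖u z‖ ^ 2 / 2 + p z) * u z j) x (EuclideanSpace.single j 1)) :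
    ∫ x, g (x 2) * (2 * ⟪u x, ν • Δ u x - convect u u x - gradient p x⟫) =
      ν * (∫ x, deriv (deriv g) (x 2) * ‖u x‖ ^ 2) -
        2 * ν * (∫ x, g (x 2) * ∑ j : Fin 3, ‖fderiv ℝ u x (EuclideanSpace.single j 1)‖ ^ 2) +
        2 * (∫ x, deriv g (x 2) * ((‖u x‖ ^ 2 / 2 + p x) * u x 2)) := by
  have hgc : Continuous g := hg.continuous
  have hu1 : ContDiff ℝ 1 u := hu.of_le one_le_two
  have hpt := two_mul_inner_acc hu (hp.differentiable one_ne_zero) hdiv ν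
  -- integrability of the three weighted densities
  have hA : Integrable fun x => g (x 2) * ∑ j : Fin 3,
      fderiv ℝ (fun z => ⟪u z, fderiv ℝ u z (EuclideanSpace.single j 1)⟫) x (EuclideanSpace.single j 1) :=
    integrable_weight_mul (integrable_finsetSum _ fun j _ => hIψ' j) hgc hgK
  have hD : Integrable fun x => g (x 2) * ∑ j : Fin 3, ‖fderiv ℝ u x (EuclideanSpace.single j 1)‖ ^ 2 :=
    integrable_weight_mul (integrable_finsetSum _ fun j _ => hID j) hgc hgK
  have hF : Integrable fun x => g (x 2) * ∑ j : Fin 3,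
      fderiv ℝ (fun z => (‖u z‖ ^ 2 / 2 + p z) * u z j) x (EuclideanSpace.single j 1) :=
    integrable_weight_mul (integrable_finsetSum _ fun j _ => hIΦ' j) hgc hgK
  -- the two divergence sums against the weight
  have hT1 := sum_integral_weight_mul_fderiv_inner_fderiv hu hg hgK hg'K hg''K hIu2 hIψ hIψ'
  have hT3 := sum_integral_weight_mul_fderiv_bernoulli hu1 hp (hg.of_le one_le_two) hgK hg'K hIΦ hIΦ'
  have hT1' : ∫ x, g (x 2) * ∑ j : Fin 3,
      fderiv ℝ (fun z => ⟪u z, fderiv ℝ u z (EuclideanSpace.single j 1)⟫) x (EuclideanSpace.single j 1) =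
      2⁻¹ * ∫ x, deriv (deriv g) (x 2) * ‖u x‖ ^ 2 := by
    rw [← hT1, ← integral_finsetSum _ (fun j _ => integrable_weight_mul (hIψ' j) hgc hgK)]
    refine integral_congr_ae (ae_of_all _ fun x => ?_)
    dsimp only
    rw [Finset.mul_sum]
  have hT3' : ∫ x, g (x 2) * ∑ j : Fin 3,
      fderiv ℝ (fun z => (‖u z‖ ^ 2 / 2 + p z) * u z j) x (EuclideanSpace.single j 1) =
      -∫ x, deriv g (x 2) * ((‖u x‖ ^ 2 / 2 + p x) * u x 2) := by
    rw [← hT3, ← integral_finsetSum _ (fun j _ => integrable_weight_mul (hIΦ' j) hgc hgK)]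
    refine integral_congr_ae (ae_of_all _ fun x => ?_)
    dsimp only
    rw [Finset.mul_sum]
  -- integrate the pointwise identity
  have hsplit : (fun x => g (x 2) * (2 * ⟪u x, ν • Δ u x - convect u u x - gradient p x⟫)) =
      fun x => 2 * ν * (g (x 2) * ∑ j : Fin 3,
        fderiv ℝ (fun z => ⟪u z, fderiv ℝ u z (EuclideanSpace.single j 1)⟫) x (EuclideanSpace.single j 1)) -
        2 * ν * (g (x 2) * ∑ j : Fin 3, ‖fderiv ℝ u x (EuclideanSpace.single j 1)‖ ^ 2) -
        2 * (g (x 2) * ∑ j : Fin 3,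
          fderiv ℝ (fun z => (‖u z‖ ^ 2 / 2 + p z) * u z j) x (EuclideanSpace.single j 1)) := by
    funext x; rw [hpt x]; ring
  have hI1 : Integrable fun x => 2 * ν * (g (x 2) * ∑ j : Fin 3,
        fderiv ℝ (fun z => ⟪u z, fderiv ℝ u z (EuclideanSpace.single j 1)⟫) x (EuclideanSpace.single j 1)) -
        2 * ν * (g (x 2) * ∑ j : Fin 3, ‖fderiv ℝ u x (EuclideanSpace.single j 1)‖ ^ 2) :=
    (hA.const_mul _).sub (hD.const_mul _)
  have hI2 : Integrable fun x => 2 * (g (x 2) * ∑ j : Fin 3,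
      fderiv ℝ (fun z => (‖u z‖ ^ 2 / 2 + p z) * u z j) x (EuclideanSpace.single j 1)) := hF.const_mul _
  have hI3 : Integrable fun x => 2 * ν * (g (x 2) * ∑ j : Fin 3,
      fderiv ℝ (fun z => ⟪u z, fderiv ℝ u z (EuclideanSpace.single j 1)⟫) x (EuclideanSpace.single j 1)) :=
    hA.const_mul _
  have hI4 : Integrable fun x => 2 * ν * (g (x 2) * ∑ j : Fin 3, ‖fderiv ℝ u x (EuclideanSpace.single j 1)‖ ^ 2) :=
    hD.const_mul _
  rw [hsplit, integral_sub hI1 hI2, integral_sub hI3 hI4, integral_const_mul, integral_const_mul,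
    integral_const_mul, hT1', hT3']
  ring

/-- **The weighted energy identity under order-(3,2) decay** (the form registered on the line as
`weightedEnergyIdentity`, seat 3's helper 1/5 toward `stub_slabLawMild`): the six densities are
integrable by the landed `decayDensitiesIntegrable`, so `weightedEnergyIdentity_of_integrable`
applies. [folklore] -/
theorem weightedEnergyIdentity_of_decay (ν : ℝ) (hu : ContDiff ℝ 2 u) (hp : ContDiff ℝ 1 p)
    (hdiv : VectorCalculus.IsDivFree u) {C : ℝ}
    (h0 : ∀ x, ‖u x‖ ≤ C * (1 + ‖x‖) ^ (-(3 : ℝ))) (h1 : ∀ x, ‖fderiv ℝ u x‖ ≤ C * (1 + ‖x‖) ^ (-(3 : ℝ)))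
    (h2 : ∀ x, ‖iteratedFDeriv ℝ 2 u x‖ ≤ C * (1 + ‖x‖) ^ (-(3 : ℝ)))
    (k0 : ∀ x, ‖p x‖ ≤ C * (1 + ‖x‖) ^ (-(2 : ℝ))) (k1 : ∀ x, ‖fderiv ℝ p x‖ ≤ C * (1 + ‖x‖) ^ (-(2 : ℝ)))
    {g : ℝ → ℝ} (hg : ContDiff ℝ 2 g) {K : ℝ} (hgK : ∀ z, |g z| ≤ K) (hg'K : ∀ z, |deriv g z| ≤ K)
    (hg''K : ∀ z, |deriv (deriv g) z| ≤ K) :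
    ∫ x, g (x 2) * (2 * ⟪u x, ν • Δ u x - convect u u x - gradient p x⟫) =
      ν * (∫ x, deriv (deriv g) (x 2) * ‖u x‖ ^ 2) -
        2 * ν * (∫ x, g (x 2) * ∑ j : Fin 3, ‖fderiv ℝ u x (EuclideanSpace.single j 1)‖ ^ 2) +
        2 * (∫ x, deriv g (x 2) * ((‖u x‖ ^ 2 / 2 + p x) * u x 2)) := by
  have hI := decayDensitiesIntegrable u p C hu hp h0 h1 h2 k0 k1
  exact weightedEnergyIdentity_of_integrable ν hu hp hdiv hg hgK hg'K hg''K (hI 0).1 (fun j => (hI j).2.1)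
    (fun j => (hI j).2.2.1) (fun j => (hI j).2.2.2.1) (fun j => (hI j).2.2.2.2.1) (fun j => (hI j).2.2.2.2.2)

/-- **`weightedEnergyIdentity`, the registered helper of the line `birth`** (registered by seat 3
toward `stub_slabLawMild`; statement verbatim): the weighted whole-space energy identity under
order-(3,2) decay. [folklore] -/
theorem weightedEnergyIdentity : ∀ (ν : ℝ) (u : EuclideanSpace ℝ (Fin 3) → EuclideanSpace ℝ (Fin 3)) (p : EuclideanSpace ℝ (Fin 3) → ℝ) (C : ℝ), ContDiff ℝ 2 u → ContDiff ℝ 1 p → Literature.Analysis.FluidPDE.VectorCalculus.IsDivFree u → (∀ x, ‖u x‖ ≤ C * (1 + ‖x‖) ^ (-(3 : ℝ))) → (∀ x, ‖fderiv ℝ u x‖ ≤ C * (1 + ‖x‖) ^ (-(3 : ℝ))) → (∀ x, ‖iteratedFDeriv ℝ 2 u x‖ ≤ C * (1 + ‖x‖) ^ (-(3 : ℝ))) → (∀ x, ‖p x‖ ≤ C * (1 + ‖x‖) ^ (-(2 : ℝ))) → (∀ x, ‖fderiv ℝ p x‖ ≤ C * (1 + ‖x‖) ^ (-(2 : ℝ)))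 → ∀ (g : ℝ → ℝ) (K : ℝ), ContDiff ℝ 2 g → (∀ z, |g z| ≤ K) → (∀ z, |deriv g z| ≤ K) → (∀ z, |deriv (deriv g) z| ≤ K) → ∫ x, g (x 2) * (2 * inner ℝ (u x) (ν • Laplacian.laplacian u x - Literature.Analysis.FluidPDE.convect u u x - gradient p x)) = ν * (∫ x, deriv (deriv g) (x 2) * ‖u x‖ ^ 2) - 2 * ν * (∫ x, g (x 2) * ∑ j : Fin 3, ‖fderiv ℝ u x (EuclideanSpace.single j 1)‖ ^ 2) + 2 * (∫ x, deriv g (x 2) * ((‖u x‖ ^ 2 / 2 + p x) * u x 2)) :=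
  fun ν _ _ _ hu hp hdiv h0 h1 h2 k0 k1 _ _ hg hgK hg'K hg''K =>
    weightedEnergyIdentity_of_decay ν hu hp hdiv h0 h1 h2 k0 k1 hg hgK hg'K hg''K

end Identity

end Summit.NavierStokesRegularity.NavierStokesRegularity.Theorems.PlanarEnergyAPriori

end
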